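import Mathlib
import Summits.ValiantsHypothesis.ValiantsHypothesis.Theses.ValuativeGCT
import Summits.ValiantsHypothesis.ValiantsHypothesis.Theorems.ValuativeGCTNoValuativeFlipUnconditional

/-!
# `TailFlip` — negative lemmas I: the window top and the threshold are load-bearing

Crux `stmt-ValiantsHypothesis-15687` (`Theses.ValuativeGCT.TailFlip`, route ValuativeGCT, rev 4):
`∀ a b, b < a → ∀ c, ∃ n₀, ∀ n ≥ n₀, ∀ m [NeZero m], a·n < b·m → m ≤ 2^((log₂ n + c)^c) → FlipAt n m`
with `FlipAt n m` VERBATIM the crux body (`tailFlip_iff : … := Iff.rfl`): some centre `(U, r)`, degree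
`δ`, shape `λ ⊢ mδ` (`≤ m²` parts) with `dim T_U(λ) < mult_{λ*} ℂ[Δ_m(X₀₀^(m-n) per_n)]`.  Standing
disprover (cdisprove cycle 1, 2026-08-16), `Cruxes/TailFlip/Disproof.lean` §0–§2 and §4 (the two
"must deliver" consequences) restated for the tree.  Nothing here asserts a route statement
positively; every theorem is sorry-free.

* §1 the no-flip engine in `FlipAt` currency: `not_flipAt_of_two_pow_le` (Grenet + MS 2001 Prop. 4.4 +
  `ValuativeBound_proof`, tree `noValuativeFlip_body_of_two_pow_le'`); so `n ≤ 2` never flips,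
  `n = 3` only at `m ≤ 6`, `n = 4` only at `m ≤ 14` (`not_flipAt_zero/one/two/three/four`).
* §2 LOAD-BEARING clauses ("any proof must use …"): the window TOP (`not_tailFlipWithoutTop`, witness
  `m = 2^n₀ + 2n₀ + 1`); the THRESHOLD (`not_tailFlipAllN`, witness `(a,b,c,n,m) = (4,3,1,2,3)`;
  `threshold_ne_zero`: `(0, 1)` is a flipless tail instance for every finite slope and every `c`); the
  threshold must DEPEND on `c` (`not_tailFlipUniform`) and is LARGE: from `n₀` on the window top is
  below Grenet's bound wherever the slope admits it (`two_pow_windowTop_lt_of_flipsFrom`), whence for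
  slope `2/1`: `(log₂ n + c)^c < n` for all `n ≥ max n₀ 3` (`log_add_pow_lt_of_flipsFrom`),
  `n₀(c) > c^c` (`pow_self_lt_threshold`), `n₀(2) ≥ 65` (`threshold_two`), `n₀(3) ≥ 2745`
  (`threshold_three`).  Normal form: slopes `(b+1)/b` suffice (`tailFlip_iff_succSlopes`).
* §3 what any proof must deliver: a flip at every polynomial padding `m = n^(c₀+2)`
  (`flipAt_pow_of_tailFlip`), at the first slope-2 cells `(n, 2n+1)` (`flipAt_two_mul_succ_of_tailFlip`)
  and on the dyadic blocks `((1+1/b)·2^k, 2^(k+1)]` of the `c = 1` window (`flipAt_dyadic_of_tailFlip`).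

Sources: Grenet 2011 Thm 1; Mulmuley–Sohoni 2001 Prop. 4.4; BLMW 2011 (arXiv:0907.2850) §5;
Bläser–Ikenmeyer 2025 (doi:10.4086/toc.gs.2025.010) §12.4; this route's
`Theorems/ValuativeGCTNoValuativeFlip{BeyondGrenet,Reductions,Unconditional}`. [folklore]
-/

-- `Summit.ValiantsHypothesis.ValiantsHypothesis.…` repeats a component by the D-0017 layout
-- (single-conjunct summit), which the `dupNamespace` linter flags; the name is mandated.
set_option linter.dupNamespace false

namespace Summit.ValiantsHypothesis.ValiantsHypothesis.Theorems.TailFlip.Negative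

open Literature.NumberTheory.DiophantineGeometry Literature.Computability.AlgebraicComplexity
open Summit.ValiantsHypothesis.ValiantsHypothesis.Theses.ValuativeGCT
open Summit.ValiantsHypothesis.ValiantsHypothesis.Theorems.NoValuativeFlip
open Summit.ValiantsHypothesis.ValiantsHypothesis.Theorems.ValuativeBound

/-! ## §0 The crux body, verbatim -/

/-- `FlipAt n m`: the flip body of the crux at inner size `n` and determinant size `m`, VERBATIM
(some centre `(U, r)`, degree `δ`, shape `λ ⊢ mδ` with `≤ m²` parts, `dim T_U(λ) < mult_pp(λ*)`). -/
def FlipAt (n m : ℕ) [NeZero m] : Prop :=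
  ∃ (U : Submodule ℂ (Literature.NumberTheory.DiophantineGeometry.MatIdx m → ℂ)) (r δ : ℕ) (lam : Nat.Partition (m * δ)), (∀ u ∈ U, (Matrix.of fun a b : Fin m => u (toLex (a, b))).rank ≤ r) ∧ lam.parts.card ≤ m * m ∧ (let χ : Literature.NumberTheory.DiophantineGeometry.Weight (Literature.NumberTheory.DiophantineGeometry.MatIdx m) := (Literature.NumberTheory.DiophantineGeometry.Weight.dualOfPartition (m * m) lam).toMatIdx; let T : Submodule ℂ (MvPolynomial (Literature.NumberTheory.DiophantineGeometry.MatIdx m × Literature.NumberTheory.DiophantineGeometry.MatIdx m) ℂ) := MvPolynomial.homogeneousSubmodule (Literature.NumberTheory.DiophantineGeometry.MatIdx m × Literature.NumberTheory.DiophantineGeometry.MatIdx m) ℂ (m * δ) ⊓ ((MvPolynomial.vanishingIdeal ℂ {p : Literature.NumberTheory.DiophantineGeometry.MatIdx m × Literature.NumberTheory.DiophantineGeometry.MatIdx m → ℂ | ∀ j : Literature.NumberTheory.DiophantineGeometry.MatIdx m, (fun i => p (j, i)) ∈ U}) ^ (δ * (m - r))).restrictScalars ℂ ⊓ (⨅ (M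 : Matrix (Literature.NumberTheory.DiophantineGeometry.MatIdx m) (Literature.NumberTheory.DiophantineGeometry.MatIdx m) ℂ) (_ : Literature.Computability.AlgebraicComplexity.linSubst (Literature.NumberTheory.DiophantineGeometry.MatIdx m) ℂ M (Literature.NumberTheory.DiophantineGeometry.detFormLex ℂ m) = Literature.NumberTheory.DiophantineGeometry.detFormLex ℂ m), LinearMap.ker ((MvPolynomial.aeval (R := ℂ) fun p : Literature.NumberTheory.DiophantineGeometry.MatIdx m × Literature.NumberTheory.DiophantineGeometry.MatIdx m => ∑ l : Literature.NumberTheory.DiophantineGeometry.MatIdx m, M l p.2 • MvPolynomial.X (p.1, l)).toLinearMap - LinearMap.id (R := ℂ) (M := MvPolynomial (Literature.NumberTheory.DiophantineGeometry.MatIdx m × Literature.NumberTheory.DiophantineGeometry.MatIdx m) ℂ))) ⊓ (⨅ (g : Matrix.GeneralLinearGroup (Literature.NumberTheory.DiophantineGeometry.MatIdx m) ℂ) (_ : Literature.NumberTheory.DiophantineGeometry.IsUpperTriangular g), LinearMap.ker ((MvPolynomial.aeval (R := ℂ) fun p : Literature.NumberTheory.DiophantineGeometry.MatIdx m × Literature.NumberTheory.DiophantineGeometry.MatIdx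 m => ∑ l : Literature.NumberTheory.DiophantineGeometry.MatIdx m, ((g⁻¹ : Matrix.GeneralLinearGroup (Literature.NumberTheory.DiophantineGeometry.MatIdx m) ℂ) : Matrix (Literature.NumberTheory.DiophantineGeometry.MatIdx m) (Literature.NumberTheory.DiophantineGeometry.MatIdx m) ℂ) p.1 l • MvPolynomial.X (l, p.2)).toLinearMap - Literature.NumberTheory.DiophantineGeometry.weightChar χ g • LinearMap.id (R := ℂ) (M := MvPolynomial (Literature.NumberTheory.DiophantineGeometry.MatIdx m × Literature.NumberTheory.DiophantineGeometry.MatIdx m) ℂ))); Module.finrank ℂ ↥T < Literature.NumberTheory.DiophantineGeometry.orbitMultiplicity ℂ (Literature.NumberTheory.DiophantineGeometry.paddedPerFormLex ℂ n m) m χ)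

/-- The crux is literally `∀ slope > 1, ∀ c, eventually in n, ∀ m in the tail window, FlipAt n m`. -/
theorem tailFlip_iff :
    TailFlip ↔ ∀ a b : ℕ, b < a → ∀ c : ℕ, ∃ n₀ : ℕ, ∀ n ≥ n₀, ∀ (m : ℕ) [NeZero m],
      a * n < b * m → m ≤ 2 ^ ((Nat.log 2 n + c) ^ c) → FlipAt n m :=
  Iff.rfl

/-- **Normal form of the slope quantifier**: the slopes `(b+1)/b`, `b ≥ 1`, suffice — the tail of
a slope `a/b > 1` (`a ≥ b + 1`) is contained in the tail of `(b+1)/b`, and `b = 0` is vacuous. -/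
theorem tailFlip_iff_succSlopes :
    TailFlip ↔ ∀ b : ℕ, 0 < b → ∀ c : ℕ, ∃ n₀ : ℕ, ∀ n ≥ n₀, ∀ (m : ℕ) [NeZero m],
      (b + 1) * n < b * m → m ≤ 2 ^ ((Nat.log 2 n + c) ^ c) → FlipAt n m := by
  constructor
  · intro h b _ c
    exact h (b + 1) b (Nat.lt_succ_self b) c
  · intro h a b hba c
    rcases Nat.eq_zero_or_pos b with rfl | hb
    · exact ⟨0, fun n _ m _ hlt _ => absurd hlt (by simp)⟩
    · obtain ⟨n₀, hn₀⟩ := h b hb c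
      refine ⟨n₀, fun n hn m _ hlt hm => hn₀ n hn m ?_ hm⟩
      have : (b + 1) * n ≤ a * n := Nat.mul_le_mul_right n hba
      omega

/-! ## §1 The no-flip engines in `FlipAt` currency -/

/-- **No flip beyond Grenet's bound** `2ⁿ ≤ m + 1`: there `X₀₀^(m-n) per_n ∈ Δ(det_m)` (Grenet 2011 +
Mulmuley–Sohoni 2001 Prop. 4.4), so `mult_pp(λ*) ≤ K_m(λ*) ≤ dim T_U(λ)` for every centre
(`noValuativeFlip_body_of_two_pow_le'`, with `ValuativeBound_proof`). -/
theorem not_flipAt_of_two_pow_le {n m : ℕ} [NeZero m] (hm : 2 ^ n ≤ m + 1) : ¬ FlipAt n m := by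
  rintro ⟨U, r, δ, lam, hU, hcard, hlt⟩
  exact (not_le.mpr hlt) (noValuativeFlip_body_of_two_pow_le' m hm U r hU δ lam hcard)

/-- `n = 0` (`per_0 = 1`, `pp = X₀₀^m`) never flips. -/
theorem not_flipAt_zero (m : ℕ) [NeZero m] : ¬ FlipAt 0 m :=
  not_flipAt_of_two_pow_le (by rw [pow_zero]; exact Nat.le_add_left 1 m)

/-- `n = 1` (`per_1 = x`, `pp = X₀₀^(m-1) x`) never flips. -/
theorem not_flipAt_one (m : ℕ) [NeZero m] : ¬ FlipAt 1 m :=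
  not_flipAt_of_two_pow_le (by rw [pow_one]; exact Nat.succ_le_succ NeZero.one_le)

/-- `n = 2` (`per_2 ≅ det_2`) never flips in the tail (`m ≥ 3`). -/
theorem not_flipAt_two {m : ℕ} [NeZero m] (hm : 3 ≤ m) : ¬ FlipAt 2 m :=
  not_flipAt_of_two_pow_le (by norm_num; omega)

/-- `n = 3`: no flip at `m ≥ 7 = dc(per_3)`; the only conceivable tail cells are `m ∈ {4, 5, 6}`. -/
theorem not_flipAt_three {m : ℕ} [NeZero m] (hm : 7 ≤ m) : ¬ FlipAt 3 m :=
  not_flipAt_of_two_pow_le (by norm_num; omega)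

/-- `n = 4`: no flip at `m ≥ 15`; conceivable tail cells `m ∈ {5, …, 14}`. -/
theorem not_flipAt_four {m : ℕ} [NeZero m] (hm : 15 ≤ m) : ¬ FlipAt 4 m :=
  not_flipAt_of_two_pow_le (by norm_num; omega)

/-! ## §2 Load-bearing clauses of the crux (any proof must use …) -/

/-- The crux with the window's TOP `m ≤ 2^((log₂ n + c)^c)` deleted (then `c` is idle and dropped). -/
def TailFlipWithoutTop : Prop :=
  ∀ a b : ℕ, b < a → ∃ n₀ : ℕ, ∀ n ≥ n₀, ∀ (m : ℕ) [NeZero m], a * n < b * m → FlipAt n m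

/-- **Any proof must use the window top**: without it the tail contains Grenet's range; witness
slope `2/1`, `n = n₀`, `m = 2^n₀ + 2n₀ + 1`. -/
theorem not_tailFlipWithoutTop : ¬ TailFlipWithoutTop := by
  intro h
  obtain ⟨n₀, hn₀⟩ := h 2 1 one_lt_two
  haveI : NeZero (2 ^ n₀ + 2 * n₀ + 1) := ⟨Nat.succ_ne_zero _⟩
  have h1 : 1 ≤ 2 ^ n₀ := Nat.one_le_two_pow
  exact not_flipAt_of_two_pow_le (n := n₀) (m := 2 ^ n₀ + 2 * n₀ + 1) (by omega)
    (hn₀ n₀ le_rfl (2 ^ n₀ + 2 * n₀ + 1) (by omega))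

/-- The crux with the threshold `∃ n₀, ∀ n ≥ n₀` replaced by `∀ n`. -/
def TailFlipAllN : Prop :=
  ∀ a b : ℕ, b < a → ∀ c n : ℕ, ∀ (m : ℕ) [NeZero m],
    a * n < b * m → m ≤ 2 ^ ((Nat.log 2 n + c) ^ c) → FlipAt n m

/-- `Nat.log 2 2 = 1`. [folklore] -/
theorem log_two_two : Nat.log 2 2 = 1 :=
  Nat.log_eq_of_pow_le_of_lt_pow (by norm_num) (by norm_num)

/-- **Any proof must use the threshold**: `(a, b, c, n, m) = (4, 3, 1, 2, 3)` is a tail instance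
(`4·2 < 3·3`, `3 ≤ 2^((log₂ 2 + 1)^1) = 4`) with a genuine permanent (`per_2`) and no flip
(`2² ≤ 3 + 1`, Grenet/`per_2 = det_2`). -/
theorem not_tailFlipAllN : ¬ TailFlipAllN := fun h =>
  not_flipAt_two (m := 3) le_rfl
    (h 4 3 (by norm_num) 1 2 3 (by norm_num) (by rw [log_two_two]; norm_num))

/-- **The threshold is at least `1` for every finite slope and every `c`**: `(n, m) = (0, 1)` is in
every tail (`a·0 < b·1`, `1 ≤ 2^(…)`) and never flips. -/
theorem threshold_ne_zero {a b c n₀ : ℕ} (hb : 0 < b)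
    (h : ∀ n ≥ n₀, ∀ (m : ℕ) [NeZero m], a * n < b * m → m ≤ 2 ^ ((Nat.log 2 n + c) ^ c) → FlipAt n m) :
    n₀ ≠ 0 := by
  rintro rfl
  exact not_flipAt_zero 1 (h 0 le_rfl 1 (by simpa using hb) Nat.one_le_two_pow)

/-- **From the threshold on, the window top is below Grenet's bound** wherever the slope admits
Grenet's point: if the crux body holds at `(a, b, c)` from `n₀` on, then for every `n ≥ n₀` with
`a·n < b·(2ⁿ - 1)` one has `2^((log₂ n + c)^c) + 1 < 2ⁿ` (else `m = 2ⁿ - 1` is a tail position with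
no flip).  So every proof's threshold `n₀(a, b, c)` lies beyond the last `n` with
`(log₂ n + c)^c ≥ n` (roughly `n₀(c) > (c log₂ c)^c`). -/
theorem two_pow_windowTop_lt_of_flipsFrom {a b c n₀ : ℕ}
    (h : ∀ n ≥ n₀, ∀ (m : ℕ) [NeZero m], a * n < b * m → m ≤ 2 ^ ((Nat.log 2 n + c) ^ c) → FlipAt n m)
    {n : ℕ} (hn : n₀ ≤ n) (hslope : a * n < b * (2 ^ n - 1)) :
    2 ^ ((Nat.log 2 n + c) ^ c) + 1 < 2 ^ n := by
  by_contra hle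
  rw [not_lt] at hle
  have hpos : 0 < 2 ^ n - 1 := by
    rcases Nat.eq_zero_or_pos (2 ^ n - 1) with h0 | h0
    · rw [h0, mul_zero] at hslope
      exact absurd hslope (Nat.not_lt_zero _)
    · exact h0
  haveI : NeZero (2 ^ n - 1) := NeZero.of_pos hpos
  have h1 : 1 ≤ 2 ^ n := Nat.one_le_two_pow
  refine not_flipAt_of_two_pow_le (n := n) (m := 2 ^ n - 1) (by omega) (h n hn (2 ^ n - 1) hslope ?_)
  omega

/-- `2n + 2 ≤ 2ⁿ` for `n ≥ 3`. [folklore] -/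
theorem two_mul_add_two_le_two_pow {n : ℕ} (hn : 3 ≤ n) : 2 * n + 2 ≤ 2 ^ n := by
  induction n, hn using Nat.le_induction with
  | base => norm_num
  | succ k hk ih => rw [pow_succ]; omega

/-- The crux with a threshold UNIFORM in `c` (`∃ n₀, ∀ c` instead of `∀ c, ∃ n₀`). -/
def TailFlipUniform : Prop :=
  ∀ a b : ℕ, b < a → ∃ n₀ : ℕ, ∀ c : ℕ, ∀ n ≥ n₀, ∀ (m : ℕ) [NeZero m],
    a * n < b * m → m ≤ 2 ^ ((Nat.log 2 n + c) ^ c) → FlipAt n m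

/-- **The threshold must depend on `c`** (natural strengthening refuted): with `c = n` the window at
`n` reaches `2^((log₂ n + n)^n) ≥ 2ⁿ`, i.e. contains Grenet's point. -/
theorem not_tailFlipUniform : ¬ TailFlipUniform := by
  intro h
  obtain ⟨n₀, hn₀⟩ := h 2 1 one_lt_two
  set n : ℕ := max n₀ 3 with hn
  have hn0 : n₀ ≤ n := le_max_left _ _
  have hn3 : 3 ≤ n := le_max_right _ _
  have h2n := two_mul_add_two_le_two_pow hn3
  have hlt := two_pow_windowTop_lt_of_flipsFrom (hn₀ n) hn0 (by omega)
  have hge : 2 ^ n ≤ 2 ^ ((Nat.log 2 n + n) ^ n) :=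
    Nat.pow_le_pow_right two_pos
      ((Nat.le_add_left n (Nat.log 2 n)).trans (Nat.le_self_pow (by omega) _))
  omega

/-- **Quantitative threshold, slope `2/1`**: for `c ≥ 2`, any threshold of the crux body at
`(a, b) = (2, 1)` exceeds `c^c` (at `n = c^c`, `(log₂ n + c)^c ≥ c^c = n`, so the window contains
Grenet's point `2ⁿ - 1 > 2n`). -/
theorem pow_self_lt_threshold {c n₀ : ℕ} (hc : 2 ≤ c)
    (h : ∀ n ≥ n₀, ∀ (m : ℕ) [NeZero m], 2 * n < 1 * m → m ≤ 2 ^ ((Nat.log 2 n + c) ^ c) → FlipAt n m) :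
    c ^ c < n₀ := by
  by_contra hle
  rw [not_lt] at hle
  have hc3 : 3 ≤ c ^ c :=
    calc 3 ≤ 2 ^ 2 := by norm_num
      _ ≤ c ^ 2 := Nat.pow_le_pow_left hc 2
      _ ≤ c ^ c := Nat.pow_le_pow_right (by omega) hc
  have h2n := two_mul_add_two_le_two_pow hc3
  have hlt := two_pow_windowTop_lt_of_flipsFrom h hle (by omega)
  have hge : 2 ^ (c ^ c) ≤ 2 ^ ((Nat.log 2 (c ^ c) + c) ^ c) :=
    Nat.pow_le_pow_right two_pos (Nat.pow_le_pow_left (Nat.le_add_left c _) c)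
  omega

/-- **The threshold lies beyond the fixed point of `(log₂ n + c)^c = n`** (slope `2/1`): if the
crux body holds at `(2, 1, c)` from `n₀` on, then `(log₂ n + c)^c < n` for every `n ≥ max n₀ 3` —
otherwise the window at `n` reaches `2ⁿ > 2ⁿ - 1 ≥ 2n + 1`, Grenet's flipless point. -/
theorem log_add_pow_lt_of_flipsFrom {c n₀ : ℕ}
    (h : ∀ n ≥ n₀, ∀ (m : ℕ) [NeZero m], 2 * n < 1 * m → m ≤ 2 ^ ((Nat.log 2 n + c) ^ c) → FlipAt n m)
    {n : ℕ} (hn : n₀ ≤ n) (hn3 : 3 ≤ n) : (Nat.log 2 n + c) ^ c < n := by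
  by_contra hle
  rw [not_lt] at hle
  have h2n := two_mul_add_two_le_two_pow hn3
  have hlt := two_pow_windowTop_lt_of_flipsFrom h hn (by omega)
  have hge : 2 ^ n ≤ 2 ^ ((Nat.log 2 n + c) ^ c) := Nat.pow_le_pow_right two_pos hle
  omega

/-- **`n₀(2) ≥ 65`** for slope `2/1`: `n = 64` has `(log₂ 64 + 2)^2 = 64`, window top `2^64 ≥ 2^64 - 1`. -/
theorem threshold_two {n₀ : ℕ}
    (h : ∀ n ≥ n₀, ∀ (m : ℕ) [NeZero m], 2 * n < 1 * m → m ≤ 2 ^ ((Nat.log 2 n + 2) ^ 2) → FlipAt n m) :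
    64 < n₀ := by
  by_contra hle
  rw [not_lt] at hle
  have hlog : Nat.log 2 64 = 6 := Nat.log_eq_of_pow_le_of_lt_pow (by norm_num) (by norm_num)
  have hlt := two_pow_windowTop_lt_of_flipsFrom h hle (by norm_num)
  rw [hlog] at hlt
  norm_num at hlt

/-- **`n₀(3) ≥ 2745`** for slope `2/1`: `n = 2744 = 14³` has `log₂ 2744 = 11`, `(11 + 3)^3 = 2744`. -/
theorem threshold_three {n₀ : ℕ}
    (h : ∀ n ≥ n₀, ∀ (m : ℕ) [NeZero m], 2 * n < 1 * m → m ≤ 2 ^ ((Nat.log 2 n + 3) ^ 3) → FlipAt n m) :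
    2744 < n₀ := by
  by_contra hle
  rw [not_lt] at hle
  have hlog : Nat.log 2 2744 = 11 := Nat.log_eq_of_pow_le_of_lt_pow (by norm_num) (by norm_num)
  have h2n := two_mul_add_two_le_two_pow (show 3 ≤ 2744 by norm_num)
  have hlt := two_pow_windowTop_lt_of_flipsFrom h hle (by omega)
  rw [hlog] at hlt
  have h14 : 2 ^ ((11 + 3) ^ 3) = 2 ^ 2744 := by norm_num
  omega

/-! ## §3 What any proof must deliver -/

/-- **What any proof must deliver, I: flips at every polynomial padding.**  `TailFlip` (slope `2/1`,
window `c₀ + 3`) gives, eventually in `n`, a flip at `m = n^(c₀+2)`. -/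
theorem flipAt_pow_of_tailFlip (h : TailFlip) (c₀ : ℕ) :
    ∃ n₀ : ℕ, ∀ n ≥ n₀, ∃ _ : NeZero (n ^ (c₀ + 2)), FlipAt n (n ^ (c₀ + 2)) := by
  obtain ⟨n₁, hn₁⟩ := h 2 1 one_lt_two (c₀ + 3)
  refine ⟨max n₁ 3, fun n hn => ?_⟩
  have hn1 : n₁ ≤ n := le_of_max_le_left hn
  have hn3 : 3 ≤ n := le_of_max_le_right hn
  haveI hz : NeZero (n ^ (c₀ + 2)) := ⟨pow_ne_zero _ (by omega)⟩
  have hwin : n ^ (c₀ + 2) ≤ 2 ^ ((Nat.log 2 n + (c₀ + 3)) ^ (c₀ + 3)) :=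
    pow_succ_le_two_pow_log_add_pow n (c₀ + 1)
  have hsq : n * n ≤ n ^ (c₀ + 2) := by
    rw [← pow_two]
    exact Nat.pow_le_pow_right (by omega) (by omega)
  have htail : 2 * n < 1 * n ^ (c₀ + 2) := by nlinarith
  exact ⟨hz, hn₁ n hn1 (n ^ (c₀ + 2)) htail hwin⟩

/-- **What any proof must deliver, I′: the cells `(n, 2n + 1)`.**  Slope `2/1`, window `c = 2`
(`2n + 1 ≤ 4n ≤ 2^(log₂ n + 2) ≤ 2^((log₂ n + 2)^2)`): eventually in `n` there is a flip at `m = 2n + 1`,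
the first cell of the slope-2 tail. -/
theorem flipAt_two_mul_succ_of_tailFlip (h : TailFlip) :
    ∃ n₀ : ℕ, ∀ n ≥ n₀, FlipAt n (2 * n + 1) := by
  obtain ⟨n₁, hn₁⟩ := h 2 1 one_lt_two 2
  refine ⟨n₁, fun n hn => hn₁ n hn (2 * n + 1) (by omega) ?_⟩
  have hlt : n < 2 ^ (Nat.log 2 n + 1) := Nat.lt_pow_succ_log_self one_lt_two n
  have h1 : 2 * n + 1 ≤ 2 ^ (Nat.log 2 n + 2) := by
    rw [show Nat.log 2 n + 2 = (Nat.log 2 n + 1) + 1 from rfl, pow_succ]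
    omega
  exact h1.trans (Nat.pow_le_pow_right two_pos (Nat.le_self_pow two_ne_zero _))

/-- **What any proof must deliver, II: the dyadic blocks of the `c = 1` window.**  For slope
`(b+1)/b` and `c = 1`, at `n = 2^k` the window top is `2^(k+1) = 2n`, so `TailFlip` gives, for all
large `k`, a flip at EVERY `m` with `(b+1)·2^k < b·m ≤ b·2^(k+1)` — e.g. `m = 2n` at `n = 2^k`
(slope `< 2`), the "ratio-2 cells" `(4, 8), (8, 16), …` eventually. -/
theorem flipAt_dyadic_of_tailFlip (h : TailFlip) (b : ℕ) :
    ∃ k₀ : ℕ, ∀ k ≥ k₀, ∀ (m : ℕ) [NeZero m], (b + 1) * 2 ^ k < b * m → m ≤ 2 ^ (k + 1) →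
      FlipAt (2 ^ k) m := by
  obtain ⟨n₀, hn₀⟩ := h (b + 1) b (Nat.lt_succ_self b) 1
  refine ⟨n₀, fun k hk m _ hlt hm => hn₀ (2 ^ k) ?_ m hlt ?_⟩
  · exact hk.trans (Nat.lt_two_pow_self).le
  · rwa [Nat.log_pow one_lt_two, pow_one]

end Summit.ValiantsHypothesis.ValiantsHypothesis.Theorems.TailFlip.Negative
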